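import Literature.Analysis.FluidPDE.TaoCascadeRescaledExit
import Literature.Analysis.FluidPDE.TaoCascadeZeroScaleSetup
import Literature.Analysis.FluidPDE.TaoCascadeReducedClaim
import HarnessLib

/-!
# Tao's cascade ODE, §6.6–6.7: links between the §6.5 files, the §6.7 context, and Prop. 6.12

T. Tao, *Finite time blowup for an averaged three-dimensional Navier–Stokes equation*,
J. Amer. Math. Soc. 29 (2016), 601–674 = arXiv:1402.0290v3, §6.5 Lemma 6.9, §6.6 (the sentence after
Prop. 6.15: "Proposition 6.12 follows from Proposition 6.15 and Proposition 6.13 once we set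
`μ₁ := a₁(τ₁)` (and take `K` sufficiently large, `ε` sufficiently small, and `n₀` sufficiently
large)"), §6.7 (standing hypotheses).

Two pieces of glue for the assembly of Prop. 6.12 (`reducedClaimWith`, `TaoCascadeReducedClaim.lean`)
from the sibling files:

* `RescaledHypotheses.zeroScale_context` builds the bundle `ZeroScale.Context` of
  `TaoCascadeZeroScaleSetup.lean` (the standing hypotheses of §6.7) at a time `T ∈ [0, 100]` with
  `GoodAt` on `[0, T]`, from the corrected hypotheses of Prop. 6.5, the bounds `ZeroScale.SmallModes`
  of Prop. 6.13 (hypothesis) and Lemma 6.9 (`energy_sub_half_sum` of `TaoCascadeRescaledExit.lean`,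
  which yields `ZeroScale.PrimaryModes` with `C₅ := C₂ (1+ε₀)² (cumEnergyConst ε₀ C₃ + 100)`, i.e.
  `primaryDefect = C₅ (1+ε₀)^{-n₀/2}`);
* `ReducedConclusion.of_nextState` is the quoted sentence: the state bounds `ZeroScale.NextState`
  (6.139)–(6.144) at a time `τ₁ ∈ [1/100, T₂]`, `T₂ ≤ T₁`, together with bounds
  `|b₁(τ₁)| ≤ B_b`, `|c₁(τ₁)| ≤ B_c`, `c₁(τ₁) ≥ -B₋` of Prop. 6.13 that are small enough
  (`B_b ≤ ε/(2·10⁵)`, `B_c ≤ γ ε²/2`, `B₋ ≤ ½ (1+ε₀)^{-n₀/4}` — what "`K` large, `n₀` large" buys),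
  give the conclusion (6.104)–(6.114) of Prop. 6.12 (`ReducedConclusion γ … T₁ τ₁ μ₁`) with
  `μ₁ := a₁(τ₁)`; the only analysis is `½ ≤ (1+ε₀)^{-1/100} ≤ μ₁ ≤ (1+ε₀)^{1/100} ≤ 2`.

Theorems only.

## References

* T. Tao, J. Amer. Math. Soc. 29 (2016), 601–674 = arXiv:1402.0290v3, §6.5 Lemma 6.9, Prop. 6.12;
  §6.6 Props. 6.13, 6.15 and the sentence after Prop. 6.15; §6.7. [`Tao2016AveragedNS`]
-/

noncomputable section

open Set MeasureTheory intervalIntegral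

namespace Literature.Analysis.FluidPDE

namespace TaoCascade

open Literature.Analysis.ODE

section Context

variable {ε₀ K ε C₁ C₂ C₃ : ℝ} {n₀ N : ℤ} {τ : ℤ → ℝ} {Xr : Fin 4 → ℤ → ℝ → ℝ} {Er : ℤ → ℝ → ℝ}

/-- **The standing context `ZeroScale.Context` of §6.7 at a time `T`**, from the corrected
hypotheses of Prop. 6.5, `GoodAt` on `[0, T]` (`T ∈ [0, 100]`), the bounds of Prop. 6.13 on `b₁, c₁`
(`ZeroScale.SmallModes`, hypothesis) and Lemma 6.9 (`energy_sub_half_sum`, which gives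
`ZeroScale.PrimaryModes` with `C₅ = C₂ (1+ε₀)² (cumEnergyConst ε₀ C₃ + 100)`).
[cite: Tao2016AveragedNS, §6.5 Lemma 6.9; §6.7] -/
theorem RescaledHypotheses.zeroScale_context
    (h : RescaledHypotheses (1 / 10 ^ 5 * Real.exp (-K ^ 10 / 2)) ε₀ K ε C₁ C₂ C₃ n₀ N τ Xr Er)
    (hε₀ : 0 < ε₀) (hε₀1 : ε₀ < 1) (hK : 2 ≤ K) (hε : 0 < ε) (hε1 : ε ≤ 1) (hC₁ : 0 ≤ C₁)
    (hC₂ : 0 ≤ C₂) (hC₃ : 0 ≤ C₃) (hN : n₀ ≤ N) {T : ℝ} (hT : T ∈ Icc (0 : ℝ) 100)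
    (hgood : ∀ t ∈ Icc 0 T, GoodAt ε₀ K Xr Er t) {C₄ : ℝ} (hC₄ : 0 ≤ C₄)
    (hsmall : ZeroScale.SmallModes K ε C₄ Xr T) :
    ZeroScale.Context ε₀ K ε C₁ C₂ C₃ C₄ (C₂ * (1 + ε₀) ^ (2 : ℝ) * (cumEnergyConst ε₀ C₃ + 100))
      n₀ N τ Xr Er T := by
  have hq0 : (0 : ℝ) < 1 + ε₀ := by linarith
  have hC₅ : 0 ≤ C₂ * (1 + ε₀) ^ (2 : ℝ) * (cumEnergyConst ε₀ C₃ + 100) := by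
    have := cumEnergyConst_nonneg hε₀ hC₃
    positivity
  -- Lemma 6.9 at `k = -1, 0` on `[0, T]`
  have hprim : ∀ t ∈ Icc 0 T, ∀ k : ℤ, (k = -1 ∨ k = 0 ∨ k = 1) →
      Er k t ≤ (1 / 2) * ∑ i, Xr i k t ^ 2 +
        C₂ * (1 + ε₀) ^ (2 : ℝ) * (cumEnergyConst ε₀ C₃ + 100) * (1 + ε₀) ^ (-(n₀ : ℝ) / 2) := by
    intro t ht k hk
    have ht' : t ∈ Icc (0 : ℝ) 100 := ⟨ht.1, ht.2.trans hT.2⟩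
    have h69 := (h.energy_sub_half_sum hε₀ hε₀1 hK hC₂ hC₃ hN ht'
      (fun s hs => hgood s ⟨hs.1, hs.2.trans ht.2⟩) hk).2
    have e : primaryDefect ε₀ C₂ C₃ n₀ =
        C₂ * (1 + ε₀) ^ (2 : ℝ) * (cumEnergyConst ε₀ C₃ + 100) * (1 + ε₀) ^ (-(n₀ : ℝ) / 2) := by
      unfold primaryDefect; ring
    rw [e] at h69
    linarith
  exact
    { ε₀_pos := hε₀
      ε₀_lt := hε₀1
      K_ge := hK
      ε_pos := hε
      ε_le := hε1
      C₁_nn := hC₁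
      C₂_nn := hC₂
      C₃_nn := hC₃
      C₄_nn := hC₄
      C₅_nn := hC₅
      le_N := hN
      hyp := h
      T_nn := hT.1
      T_le := hT.2
      loc := hgood
      prim := ⟨fun t ht => hprim t ht (-1) (Or.inl rfl), fun t ht => hprim t ht 0 (Or.inr (Or.inl rfl))⟩
      small := hsmall }


/-- **Prop. 6.12's conclusion from Prop. 6.15's state bounds and Prop. 6.13's bounds, with
`μ₁ := a₁(τ₁)`** (the sentence after Prop. 6.15): if `τ₁ ∈ [1/100, T₂]`, `T₂ ≤ T₁`, the bounds
(6.139)–(6.144) hold at `τ₁` (`ZeroScale.NextState`), and `|b₁(τ₁)| ≤ B_b ≤ ε/(2·10⁵)`,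
`|c₁(τ₁)| ≤ B_c ≤ γ ε²/2`, `c₁(τ₁) ≥ -B₋ ≥ -½(1+ε₀)^{-n₀/4}`, then (6.104)–(6.114) hold with
`μ₁ = a₁(τ₁)` (`ReducedConclusion γ … T₁ τ₁ (a₁ τ₁)`).
[cite: Tao2016AveragedNS, §6.6, sentence after Prop. 6.15] -/
theorem ReducedConclusion.of_nextState {γ T₁ T₂ τ₁ Bb Bc Bneg : ℝ} (hε₀ : 0 < ε₀) (hε₀1 : ε₀ < 1)
    (hK : 0 < K) (hε : 0 < ε) (hT₂ : T₂ ≤ T₁) (hτ₁ : τ₁ ∈ Icc (1 / 100) T₂)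
    (hns : ZeroScale.NextState ε₀ K ε Xr Er τ₁) (hb : |Xr 1 1 τ₁| ≤ Bb) (hc : |Xr 2 1 τ₁| ≤ Bc)
    (hcge : -Bneg ≤ Xr 2 1 τ₁) (hBb : Bb ≤ ε / (2 * 10 ^ 5)) (hBc : Bc ≤ γ * ε ^ 2 / 2)
    (hBneg : Bneg ≤ 1 / 2 * (1 + ε₀) ^ (-(n₀ : ℝ) / 4)) :
    ReducedConclusion γ ε₀ K ε n₀ Xr Er T₁ τ₁ (Xr 0 1 τ₁) := by
  have hq1 : (1 : ℝ) ≤ 1 + ε₀ := by linarith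
  set μ₁ : ℝ := Xr 0 1 τ₁ with hμ
  -- `½ ≤ μ₁ ≤ 2` and `½ ≤ μ₁²`
  have hlow : (1 + ε₀) ^ (-(1 : ℝ)) ≤ (1 + ε₀) ^ (-(1 : ℝ) / 100) :=
    Real.rpow_le_rpow_of_exponent_le hq1 (by norm_num)
  have hlow2 : (1 + ε₀) ^ (-(1 : ℝ)) ≤ (1 + ε₀) ^ (-(1 : ℝ) / 50) :=
    Real.rpow_le_rpow_of_exponent_le hq1 (by norm_num)
  have hinv : (1 / 2 : ℝ) ≤ (1 + ε₀) ^ (-(1 : ℝ)) := by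
    rw [Real.rpow_neg_one, le_inv_comm₀ (by norm_num) (by linarith)]; norm_num; linarith
  have hμ_ge : 1 / 2 ≤ μ₁ := by linarith [hns.a_one_ge]
  have hμ_le : μ₁ ≤ 2 := by
    have : (1 + ε₀) ^ ((1 : ℝ) / 100) ≤ (1 + ε₀) ^ (1 : ℝ) :=
      Real.rpow_le_rpow_of_exponent_le hq1 (by norm_num)
    rw [Real.rpow_one] at this
    linarith [hns.a_one_le]
  have hμ_sq : 1 / 2 ≤ μ₁ ^ 2 := by
    have h1 : (1 + ε₀) ^ (-(1 : ℝ) / 50) ≤ μ₁ ^ 2 := by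
      have e : ((1 + ε₀) ^ (-(1 : ℝ) / 100)) ^ 2 = (1 + ε₀) ^ (-(1 : ℝ) / 50) := by
        rw [← Real.rpow_two, ← Real.rpow_mul (by linarith)]; norm_num
      rw [← e]
      exact pow_le_pow_left₀ (by positivity) hns.a_one_ge 2
    linarith
  have hε2 : 0 < ε ^ 2 := by positivity
  refine ⟨hτ₁.1, hτ₁.2.trans hT₂, hns.a_one_ge, hns.a_one_le, rfl, ?_, ?_, ?_, ?_, ?_, ?_, ?_, ?_⟩
  · -- (6.107)
    calc |Xr 1 1 τ₁| ≤ Bb := hb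
      _ ≤ ε / (2 * 10 ^ 5) := hBb
      _ = 1 / 10 ^ 5 * ε * (1 / 2) := by ring
      _ ≤ 1 / 10 ^ 5 * ε * μ₁ := mul_le_mul_of_nonneg_left hμ_ge (by positivity)
  · -- (6.108)_γ
    have hγ0 : 0 ≤ γ * ε ^ 2 := by
      have : 0 ≤ Bc := (abs_nonneg _).trans hc
      nlinarith
    calc |Xr 2 1 τ₁| ≤ Bc := hc
      _ ≤ γ * ε ^ 2 / 2 := hBc
      _ = γ * ε ^ 2 * (1 / 2) := by ring
      _ ≤ γ * ε ^ 2 * μ₁ := mul_le_mul_of_nonneg_left hμ_ge hγ0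
  · -- (6.109)
    have h0 : 0 ≤ (1 + ε₀) ^ (-(n₀ : ℝ) / 4) := by positivity
    calc -((1 + ε₀) ^ (-(n₀ : ℝ) / 4) * μ₁) ≤ -(1 / 2 * (1 + ε₀) ^ (-(n₀ : ℝ) / 4)) := by nlinarith
      _ ≤ -Bneg := by linarith
      _ ≤ Xr 2 1 τ₁ := hcge
  · -- (6.110)
    have h0 : 0 ≤ (K ^ 20)⁻¹ := by positivity
    calc Er 0 τ₁ ≤ 1 / 2 * (K ^ 20)⁻¹ := hns.energy_le
      _ = (K ^ 20)⁻¹ * (1 / 2) := by ring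
      _ ≤ (K ^ 20)⁻¹ * μ₁ ^ 2 := mul_le_mul_of_nonneg_left hμ_sq h0
  · -- (6.111)
    calc 1 / 10 ^ 5 * ε * μ₁ ≤ 1 / 10 ^ 5 * ε * 2 := mul_le_mul_of_nonneg_left hμ_le (by positivity)
      _ = 2 / 10 ^ 5 * ε := by ring
      _ ≤ Xr 1 0 τ₁ := hns.b_zero_ge
  · -- (6.112)
    calc Xr 1 0 τ₁ ≤ 10 ^ 5 / 2 * ε := hns.b_zero_le
      _ = 10 ^ 5 * ε * (1 / 2) := by ring
      _ ≤ 10 ^ 5 * ε * μ₁ := mul_le_mul_of_nonneg_left hμ_ge (by positivity)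
  · -- (6.113)
    calc Real.exp (K ^ 9) * ε ^ 2 * μ₁ ≤ Real.exp (K ^ 9) * ε ^ 2 * 2 :=
          mul_le_mul_of_nonneg_left hμ_le (by positivity)
      _ = 2 * Real.exp (K ^ 9) * ε ^ 2 := by ring
      _ ≤ Xr 2 0 τ₁ := hns.c_zero_ge
  · -- (6.114)
    calc Xr 2 0 τ₁ ≤ Real.exp (K ^ 10) / 2 * ε ^ 2 := hns.c_zero_le
      _ = Real.exp (K ^ 10) * ε ^ 2 * (1 / 2) := by ring
      _ ≤ Real.exp (K ^ 10) * ε ^ 2 * μ₁ := mul_le_mul_of_nonneg_left hμ_ge (by positivity)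

end Context

end TaoCascade

end Literature.Analysis.FluidPDE
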